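import Mathlib
import HarnessLib
import Summits.AnomalousDissipation.AnomalousDissipation.Theses.ImpulseGrid
import Literature.Analysis.FluidPDE.TorusClassicalLerayHopfProofs
import Summits.AnomalousDissipation.AnomalousDissipation.Theorems.ImpulseGridBoundedEnergyGridStubColumnarForwardOfPlanar
import Summits.AnomalousDissipation.AnomalousDissipation.Theorems.ImpulseGridBoundedEnergyGridStubForwardAxisZeroOfAxisTwo
import Summits.AnomalousDissipation.AnomalousDissipation.Theorems.ImpulseGridBoundedEnergyGridStubGridOfColumnarForward

/-!
# `ImpulseGrid.BoundedEnergyGrid` from a planar TIME-DEPENDENT bounded-mean-energy family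
# (line `Sketch`, crux stmt-AnomalousDissipation-10430): the weakest planar door, sorry-free

Support file for the crux `Summit.AnomalousDissipation.AnomalousDissipation.Theses.ImpulseGrid.BoundedEnergyGrid`
(item stmt-AnomalousDissipation-10430), continuation lead c1. It composes the three landed plumbing stubs of
the reshaped skeleton v3 — `stub_columnarForwardOfPlanar` (p108767), `stub_forwardAxisZeroOfAxisTwo`
(p109084), `stub_gridOfColumnarForward` (p108805) — with the passage from classical solutions on the convex
forward time set `Ici 0` to global Leray–Hopf solutions
(`Torus.IsClassicalNSSolutionOn.isLerayHopfOn_of_convex`), and records three doors to the crux, weakest last: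

* `boundedEnergyGrid_of_columnarForwardAxisZero` — ONE smooth transverse columnar force `G` on `T³`
  (`x₀`-invariant, `G·e₀ = 0`, divergence free, mean zero, `G ≠ 0`) admitting, along some `ν_j → 0⁺`,
  `x₀`-invariant transverse classical solutions of `NS_{ν_j}(G)` on `[0, ∞) × T³` with zero momentum at time
  `0`, per-`j` bounded slice energies and limsup-mean energies `≤ E` ⇒ crux;
* `boundedEnergyGrid_of_columnarForwardAxisTwo` — the same with the invariant axis `2`;
* `boundedEnergyGrid_of_planarForwardFamily` — ONE smooth divergence-free mean-zero planar `g ≠ 0` on `T²`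
  admitting, along some `ν_j → 0⁺`, classical solutions of `NS_{ν_j}(g)` on `[0, ∞) × T²` with zero momentum at
  time `0`, per-`j` bounded slice energies and `meanEnergy ≤ E` ⇒ crux. Its hypothesis is the registered open
  stub `stub_planarForwardFamily` of the line: the bounded-energy half of the printed open problem of
  Constantin–Tarfulea–Vicol (arXiv:1305.7089, p. 3) at zero momentum in time-dependent form (the archived crux
  stmt-AnomalousDissipation-10786 `TwodBoundedEnergyZeroMomentum` with classical in place of Leray–Hopf
  solutions). Steady branches (`Theorems.boundedEnergyGrid_of_planarSteadyBranch`, p106249) and time-periodic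
  states (`Theorems.boundedEnergyGrid_of_columnarPeriodicZeroMomentum`, p106609) are special cases.

Mechanism (unchanged): `Φ ≡ 1`, `c = 1`, `u_j(t) = e₀ + V_j(t)`; the drift is inert on `x₀`-invariant fields.
No definitions, no named facts; pure composition.
-/

-- `Summit.<Summit>.<Problem>` is the tree's mandated summit-side namespace (CONVENTIONS §2); for this
-- single-conjunct summit the two coincide, so the duplicate is deliberate.
set_option linter.dupNamespace false

noncomputable section

open MeasureTheory Filter Topology Set
open Literature.Analysis.FunctionSpaces Literature.Analysis.FunctionSpaces.Torus
open Literature.Analysis.FluidPDE Literature.Analysis.FluidPDE.Torus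

namespace Summit.AnomalousDissipation.AnomalousDissipation.Theorems

/-- **Columnar forward family, invariant axis `0` ⇒ `BoundedEnergyGrid`.** From the Galilean column lift
(`stub_gridOfColumnarForward`: design `Φ ≡ 1`, `c = 1`, `u_j(t) = e₀ + V_j(t)`) and the fact that a classical
solution on `Ici 0 ⊇ Icc 0 T` is Leray–Hopf on `[0, T)` from its time-zero slice for every `T > 0`
(`IsClassicalNSSolutionOn.isLerayHopfOn_of_convex`). [folklore] -/
theorem boundedEnergyGrid_of_columnarForwardAxisZero :
    (∃ G : UnitAddTorus (Fin 3) → EuclideanSpace ℝ (Fin 3),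
      IsSmooth G ∧ (∀ (s : UnitAddCircle) x, G (x + Pi.single (0 : Fin 3) s) = G x) ∧
      (∀ x, G x 0 = 0) ∧ IsDivFree G ∧ HasZeroMean G ∧ G ≠ 0 ∧
      ∃ (ν : ℕ → ℝ) (V : ℕ → ℝ → UnitAddTorus (Fin 3) → EuclideanSpace ℝ (Fin 3))
        (q : ℕ → ℝ → UnitAddTorus (Fin 3) → ℝ),
        (∀ j, 0 < ν j) ∧ Tendsto ν atTop (𝓝 0) ∧
        (∀ j, IsClassicalNSSolutionOn (Ici 0) (ν j) (fun _ => G) (V j) (q j)) ∧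
        (∀ j t (s : UnitAddCircle) x, V j t (x + Pi.single (0 : Fin 3) s) = V j t x) ∧
        (∀ j t x, V j t x 0 = 0) ∧ (∀ j, HasZeroMean (V j 0)) ∧
        (∀ j, ∃ C : ℝ, ∀ t, 0 ≤ t → ∫ x, ‖V j t x‖ ^ 2 ≤ C) ∧
        ∃ E : ℝ, ∀ j, meanEnergy (V j) ≤ E) →
    Summit.AnomalousDissipation.AnomalousDissipation.Theses.ImpulseGrid.BoundedEnergyGrid := by
  intro h
  obtain ⟨Φ, G, c, hΦ, hG, hΦinv, hΦmass, hGinv, hG0, hfs, hfd, hfm, hfne, hc, ν, u, q, hν, hν0, hcl,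
    hmom, E, hE⟩ := stub_gridOfColumnarForward h
  exact ⟨Φ, G, c, hΦ, hG, hΦinv, hΦmass, hGinv, hG0, hfs, hfd, hfm, hfne, hc, ν, fun j => u j 0, u, hν,
    hν0, fun j T hT => (hcl j).isLerayHopfOn_of_convex (convex_Ici 0) hT Icc_subset_Ici_self, hmom, E, hE⟩

/-- **Columnar forward family, invariant axis `2` ⇒ `BoundedEnergyGrid`** (swap the axes `0 ↔ 2`,
`stub_forwardAxisZeroOfAxisTwo`, then `boundedEnergyGrid_of_columnarForwardAxisZero`). [folklore] -/
theorem boundedEnergyGrid_of_columnarForwardAxisTwo :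
    (∃ G : UnitAddTorus (Fin 3) → EuclideanSpace ℝ (Fin 3),
      IsSmooth G ∧ (∀ (s : UnitAddCircle) x, G (x + Pi.single (2 : Fin 3) s) = G x) ∧
      (∀ x, G x 2 = 0) ∧ IsDivFree G ∧ HasZeroMean G ∧ G ≠ 0 ∧
      ∃ (ν : ℕ → ℝ) (V : ℕ → ℝ → UnitAddTorus (Fin 3) → EuclideanSpace ℝ (Fin 3))
        (q : ℕ → ℝ → UnitAddTorus (Fin 3) → ℝ),
        (∀ j, 0 < ν j) ∧ Tendsto ν atTop (𝓝 0) ∧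
        (∀ j, IsClassicalNSSolutionOn (Ici 0) (ν j) (fun _ => G) (V j) (q j)) ∧
        (∀ j t (s : UnitAddCircle) x, V j t (x + Pi.single (2 : Fin 3) s) = V j t x) ∧
        (∀ j t x, V j t x 2 = 0) ∧ (∀ j, HasZeroMean (V j 0)) ∧
        (∀ j, ∃ C : ℝ, ∀ t, 0 ≤ t → ∫ x, ‖V j t x‖ ^ 2 ≤ C) ∧
        ∃ E : ℝ, ∀ j, meanEnergy (V j) ≤ E) →
    Summit.AnomalousDissipation.AnomalousDissipation.Theses.ImpulseGrid.BoundedEnergyGrid :=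
  fun h => boundedEnergyGrid_of_columnarForwardAxisZero (stub_forwardAxisZeroOfAxisTwo h)

/-- **Planar time-dependent bounded-mean-energy family ⇒ `BoundedEnergyGrid`** — the weakest planar door
of the line `Sketch`: if ONE smooth divergence-free mean-zero planar force `g ≠ 0` on `T²` admits, along some
`ν_j → 0⁺`, classical solutions `(v_j, q_j)` of `NS_{ν_j}(g)` on the forward time set `[0, ∞)` with zero
momentum at time `0`, slice energies bounded in time for each `j`, and limsup-mean energies
`meanEnergy v_j ≤ E`, then the crux holds (`2½`-D lift `stub_columnarForwardOfPlanar`, then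
`boundedEnergyGrid_of_columnarForwardAxisTwo`). The hypothesis is the registered open stub
`stub_planarForwardFamily` (Constantin–Tarfulea–Vicol 2013, p. 3, bounded-energy half, zero momentum,
time-dependent form; archived crux stmt-AnomalousDissipation-10786 in classical form). [folklore] -/
theorem boundedEnergyGrid_of_planarForwardFamily :
    (∃ g : UnitAddTorus (Fin 2) → EuclideanSpace ℝ (Fin 2),
      IsSmooth g ∧ IsDivFree g ∧ HasZeroMean g ∧ g ≠ 0 ∧
      ∃ (ν : ℕ → ℝ) (v : ℕ → ℝ → UnitAddTorus (Fin 2) → EuclideanSpace ℝ (Fin 2))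
        (q : ℕ → ℝ → UnitAddTorus (Fin 2) → ℝ),
        (∀ j, 0 < ν j) ∧ Tendsto ν atTop (𝓝 0) ∧
        (∀ j, IsClassicalNSSolutionOn (Ici 0) (ν j) (fun _ => g) (v j) (q j)) ∧
        (∀ j, HasZeroMean (v j 0)) ∧
        (∀ j, ∃ C : ℝ, ∀ t, 0 ≤ t → ∫ x, ‖v j t x‖ ^ 2 ≤ C) ∧
        ∃ E : ℝ, ∀ j, meanEnergy (v j) ≤ E) →
    Summit.AnomalousDissipation.AnomalousDissipation.Theses.ImpulseGrid.BoundedEnergyGrid :=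
  fun h => boundedEnergyGrid_of_columnarForwardAxisTwo (stub_columnarForwardOfPlanar h)

end Summit.AnomalousDissipation.AnomalousDissipation.Theorems

end
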